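import Literature.NumberTheory.GelbartRogawski1991.LocalKudlaSplittingInjectiveTransported
import Literature.NumberTheory.GelbartRogawski1991.LocalUnitarySplittingsCMExplicit
import Literature.NumberTheory.GelbartRogawski1991.UndoublingPlaceAssembly
import Literature.NumberTheory.Automorphic.UnitaryGroupSplitPlace
import HarnessLib

/-!
# The local splitting DETERMINES the local character, II: `s_χ = s_χ′ ⇒ χ_v = χ′_v` at a SPLIT place (any rank `n ≥ 1`)

Topic `NumberTheory/GelbartRogawski1991`; namespaces `Literature.NumberTheory.GelbartRogawski1991.UnitaryDualPair.LocalSplitting`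
(§1–§2) and `…GRConstruction` (§3).  KERNEL ONLY: theorems; no definition, no named fact, no `sorry`.  Sequel of
`LocalKudlaSplittingInjective` (the NON-SPLIT places, rank `3`) and `LocalKudlaSplittingUniqueness` (§3 there: the `β`-ratio of
two local splitting data with the same Leray section is a CHARACTER `κ` of the doubled group `H(F_v)`, trivial on `U(J) × 1` as
soon as the undoubled splittings agree, `betaRatio_inlLoc_eq_one`).

At a place `v` of `F` SPLIT in `E` (`E ⊗_F F_v` not a field; places `w ≠ c⁻¹w` above `v`) the tree's local splitting datum
is `localSplittingDatumSplit` [Kudla1994, Thm 3.1; HarrisKudlaSweet1996, §1 (1.15)]: SAME Leray section `L0D` for every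
character, and `β(g) = λ_m(ι g) · χ_w⁻¹(det g_w)` with `λ_m` character-free.  Hence `κ(g) = χ'_w(det g_w) χ_w(det g_w)⁻¹`
outright, and `κ = 1` on `U(J) × 1` reads `χ_w = χ'_w` on the determinants of `U(J)(F_v) ≅ GL_n(E_w)`
(`localPiSplitEquiv`), i.e. on all of `E_wˣ`; the tie `χ_{c⁻¹w} = χ_w⁻¹ ∘ c_*` (`IsSplitPair`) transfers the equality to
the other place, and `μ_v = ∏_{w ∣ v} χ_w` (`localMu`).

* §1 `det_inlLoc_apply` (`det (g ⊕ 1)_w = det g_w`), `exists_det_apply_eq_of_split` (every unit of `E_w` is `det u_w`,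
  `u ∈ U(J)(F_v)`, at a split place, `n ≥ 1`);
* §2 **`localMu_eq_of_localSplittingCMWith_eq_split`** ∕ `localMu_eq_of_localSplittingCM_eq_split` — for a CM field `L`, any
  symmetric `T₀ ∈ GL_n(L⁺)`, `n ≥ 1`, two splitting characters `χ, χ'` and a SPLIT `v`:
  `localSplittingCMWith … χ … v μ = localSplittingCMWith … χ' … v μ → localMu L χ v = localMu L χ' v`;
* §3 `localMu_eq_of_congrW_undoubledSplittings_s_eq_split` — the same read on the transported undoubled explicit CM packages
  of record (`congrW hT hJ (undoubledSplittings … (cmFinLocalFamily …))`), the currency of the consumers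
  ([Liu2021, App. D Lem. D.1 (3)], cell `hodgecm-mathlib`, line a4-liuD3, stub :195; split twin of
  `LocalKudlaSplittingInjectiveTransported` §3), and `localMu_eq_of_congrW_undoubledSplittings_s_eq_three` — rank `3`, EVERY
  finite place (by cases on `IsField (L ⊗ L⁺_v)`: `LocalKudlaSplittingInjectiveTransported` §3 ∕ the split twin).

## References
* [Kudla1994] S. Kudla, Israel J. Math. 87 (1994), §3, Thm. 3.1.  [HarrisKudlaSweet1996] M. Harris, S. Kudla, W. Sweet,
  J. Amer. Math. Soc. 9 (1996), §1 (1.15)–(1.16).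
* [GelbartRogawski1991] S. Gelbart, J. Rogawski, Invent. Math. 105 (1991), §3.1 Prop. 3.1.1 p. 455, Remark p. 457 L4–13.
* [Liu2021] Y. Liu, Camb. J. Math. 9 (2021), App. D Lem. D.1 (3) (l. 5233), proof l. 5249–5254.
-/

set_option autoImplicit false

noncomputable section

open NumberField IsDedekindDomain MeasureTheory Matrix
open Literature.RepresentationTheory.HeisenbergGroup
open Literature.NumberTheory.Automorphic Literature.NumberTheory.Automorphic.UnitaryGroup Literature.NumberTheory.Weil1964
open Literature.RepresentationTheory.HarrisKudlaSweet1996 Literature.NumberTheory.GaloisRepresentations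

namespace Literature.NumberTheory.GelbartRogawski1991.UnitaryDualPair.LocalSplitting

/-! ## §1 Determinants: `det (g ⊕ 1)_w = det g_w`; at a split place every unit of `E_w` is a `det u_w` -/

section Det

variable (F E : Type) [Field F] [NumberField F] [Field E] [NumberField E] [Algebra F E]
  [Algebra.IsQuadraticExtension F E] (c : E ≃ₐ[F] E) (v : HeightOneSpectrum (𝓞 F))

omit [Algebra.IsQuadraticExtension F E] in
/-- **`det ((g ⊕ 1)_w) = det (g_w)`** for the embedding `inlLoc : U(J)(F_v) →* U(J^𝔻)(F_v)`, `g ↦ g ⊕ 1`, at every place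
`w ∣ v` (`inlLoc_apply`: `(g ⊕ 1)_w = reindex e₂ (g_w ⊕ 1)`). [cite: GelbartRogawski1991, §3.1 Prop. 3.1.1 p. 455 L1–3] -/
theorem det_inlLoc_apply (n : ℕ) {T₀ : Matrix (Fin n) (Fin n) F} {J : Matrix (Fin n) (Fin n) E}
    (hJ : J = T₀.map (algebraMap F E)) {JD : Matrix (Fin (n + n)) (Fin (n + n)) E}
    (hJD : JD = (gramD F n T₀).map (algebraMap F E)) (g : UnitaryGroup.localPi E c n J v) (w : PlacesOver E v) :
    Matrix.GeneralLinearGroup.det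
        (((inlLoc F E c v n hJ hJD g : UnitaryGroup.localPi E c (n + n) JD v) : UnitaryGroup.LocalGLPi E (n + n) v) w) =
      Matrix.GeneralLinearGroup.det ((g : UnitaryGroup.LocalGLPi E n v) w) := by
  refine Units.ext ?_
  rw [Matrix.GeneralLinearGroup.val_det_apply, Matrix.GeneralLinearGroup.val_det_apply, inlLoc_apply,
    UnitaryGroup.coe_reindexGL, UnitaryGroup.coe_blockDiagGL, Matrix.det_reindex_self, Matrix.det_fromBlocks_zero₂₁,
    Units.val_one, Matrix.det_one, mul_one]

omit [NumberField F] [NumberField E] [Algebra.IsQuadraticExtension F E] in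
/-- `J = T₀ ⊗ 1` with `T₀` symmetric is hermitian: `(c J)ᵀ = J`. [cite: GelbartRogawski1991, §1.1 p. 449] -/
private theorem conj_transpose_of_eq_map {n : ℕ} {T₀ : Matrix (Fin n) (Fin n) F} (hT₀ : T₀.IsSymm)
    {J : Matrix (Fin n) (Fin n) E} (hJ : J = T₀.map (algebraMap F E)) : (J.map c)ᵀ = J := by
  rw [hJ]
  ext i j
  simp only [Matrix.transpose_apply, Matrix.map_apply, AlgEquiv.commutes]
  rw [hT₀.apply i j]

omit [NumberField F] [Algebra.IsQuadraticExtension F E] in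
/-- `J = T₀ ⊗ 1` with `det T₀` a unit is invertible at every place `w`. [cite: GelbartRogawski1991, §1.1 p. 449] -/
private theorem isUnit_placeForm_of_eq_map {n : ℕ} {T₀ : Matrix (Fin n) (Fin n) F} (hT₀d : IsUnit T₀.det)
    {J : Matrix (Fin n) (Fin n) E} (hJ : J = T₀.map (algebraMap F E)) (w : HeightOneSpectrum (𝓞 E)) :
    IsUnit (placeForm J w) := by
  refine isUnit_placeForm J ((Matrix.isUnit_iff_isUnit_det _).2 ?_) w
  rw [hJ, ← RingHom.mapMatrix_apply, ← RingHom.map_det]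
  exact hT₀d.map _

/-- **at a SPLIT place every unit of `E_w` is a determinant `det u_w`, `u ∈ U(J)(F_v)`** (`n ≥ 1`): `U(J)(F_v) ≅ GL_n(E_w)` by
`u ↦ u_w` (`localPiSplitEquiv`), and `diag(a, 1, …, 1)` has determinant `a`. [cite: GelbartRogawski1991, §3.1 p. 456] -/
theorem exists_det_apply_eq_of_split (hc : c ≠ 1) {n : ℕ} (hn : 0 < n) {T₀ : Matrix (Fin n) (Fin n) F} (hT₀ : T₀.IsSymm)
    (hT₀d : IsUnit T₀.det) {J : Matrix (Fin n) (Fin n) E} (hJ : J = T₀.map (algebraMap F E)) (w : PlacesOver E v)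
    (hw : c • w.1 ≠ w.1) (a : (w.1.adicCompletion E)ˣ) :
    ∃ u : UnitaryGroup.localPi E c n J v, Matrix.GeneralLinearGroup.det ((u : UnitaryGroup.LocalGLPi E n v) w) = a := by
  classical
  set d : Fin n → w.1.adicCompletion E := Function.update (fun _ => 1) ⟨0, hn⟩ (a : w.1.adicCompletion E) with hd
  have hdet : (Matrix.diagonal d).det = a := by
    rw [Matrix.det_diagonal, hd, Finset.prod_update_of_mem (Finset.mem_univ _), Finset.prod_const_one, mul_one]
  have hne : (Matrix.diagonal d).det ≠ 0 := by
    rw [hdet]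
    exact a.ne_zero
  set e := localPiSplitEquiv c J hc (conj_transpose_of_eq_map F E c hT₀ hJ) w hw (isUnit_placeForm_of_eq_map F E hT₀d hJ w.1)
    with he
  refine ⟨e.symm (Matrix.GeneralLinearGroup.mkOfDetNeZero _ hne), ?_⟩
  have happ : ((e.symm (Matrix.GeneralLinearGroup.mkOfDetNeZero _ hne) : UnitaryGroup.localPi E c n J v) :
      UnitaryGroup.LocalGLPi E n v) w = Matrix.GeneralLinearGroup.mkOfDetNeZero _ hne := by
    rw [← localPiSplitEquiv_apply c J hc (conj_transpose_of_eq_map F E c hT₀ hJ) w hw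
      (isUnit_placeForm_of_eq_map F E hT₀d hJ w.1), ← he]
    exact e.apply_symm_apply _
  rw [happ]
  exact Units.ext (by rw [Matrix.GeneralLinearGroup.val_det_apply]; exact hdet)

end Det

/-! ## §2 `s_χ = s_χ′ ⇒ μ_v(χ) = μ_v(χ′)` at a split place -/

/-- **Kudla's splitting DETERMINES the local character at a SPLIT place**: for a CM field `L`, any symmetric
`T₀ ∈ GL_n(L⁺)` (`n ≥ 1`), two splitting characters `χ, χ'` and a finite place `v` of `L⁺` with `L ⊗ L⁺_v` NOT a field, if
the undoubled CM local splittings coincide (`localSplittingCMWith`, Haar data `μ`), then `localMu L χ v = localMu L χ' v`.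
Proof: both CM data at `v` are the split datum (`localSplittingDatumSplit` at the place `w ∣ v` of record, `c • w ≠ w`) with
the SAME Leray section, so the `β`-ratio character `κ` of `LocalKudlaSplittingUniqueness` is
`χ'_w⁻¹(det ·_w)⁻¹ χ_w⁻¹(det ·_w)` (`betaSplitDoubled`, the stabiliser factor `λ_m` being character-free); `κ (u ⊕ 1) = 1`
(`betaRatio_inlLoc_eq_one`) and `det (u ⊕ 1)_w = det u_w` exhausting `E_wˣ` (`exists_det_apply_eq_of_split`) give
`χ_w = χ'_w`; the split-pair tie (`isSplitPair_localComponent_inv`) gives `χ_{c⁻¹w} = χ'_{c⁻¹w}`; these are all the places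
above `v` (`PlacesOver.eq_or_eq_galInv`), and `μ_v = ∏_w χ_w` (`localMu`).
[cite: Kudla1994, §3 Thm. 3.1] [cite: HarrisKudlaSweet1996, §1 (1.15)] [cite: GelbartRogawski1991, §3.1 Remark p. 457 L4–13] -/
theorem localMu_eq_of_localSplittingCMWith_eq_split (L : Type) [Field L] [NumberField L] [IsCMField L]
    {n : ℕ} (hn : 0 < n) {T₀ : Matrix (Fin n) (Fin n) ↥(maximalRealSubfield L)} (hT₀ : T₀.IsSymm) (hT₀d : IsUnit T₀.det)
    {J : Matrix (Fin n) (Fin n) L} (hJ : J = T₀.map (algebraMap ↥(maximalRealSubfield L) L)) (χ χ' : HeckeCharacter L)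
    (hχ : IsSplittingChar L 1 χ) (hχ' : IsSplittingChar L 1 χ') (v : HeightOneSpectrum (𝓞 ↥(maximalRealSubfield L)))
    [MeasurableSpace (v.adicCompletion ↥(maximalRealSubfield L))] [BorelSpace (v.adicCompletion ↥(maximalRealSubfield L))]
    (μ : Measure (v.adicCompletion ↥(maximalRealSubfield L))) [μ.IsAddHaarMeasure]
    (hE : ¬ IsField (LocalRing L v))
    (heq : localSplittingCMWith L n hT₀ hT₀d hJ χ hχ v μ = localSplittingCMWith L n hT₀ hT₀d hJ χ' hχ' v μ) :
    localMu L χ v = localMu L χ' v := by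
  classical
  have hc : IsCMField.complexConj L ≠ 1 := IsCMField.complexConj_ne_one L
  have hs : ∃ w : PlacesOver L v, IsCMField.complexConj L • w.1 ≠ w.1 := by
    by_contra h
    obtain ⟨w⟩ : Nonempty (PlacesOver L v) := inferInstance
    exact hE (LocalRing.isField_of_smul_eq (IsCMField.complexConj L) hc w (not_not.1 ((not_exists.1 h) w)))
  have hw₀ : IsCMField.complexConj L • hs.choose.1 ≠ hs.choose.1 := hs.choose_spec
  set D := localSplittingDatumCM L v μ n hT₀ hT₀d rfl χ hχ with hDdef
  set D' := localSplittingDatumCM L v μ n hT₀ hT₀d rfl χ' hχ' with hD'def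
  have hD : D = localSplittingDatumSplit (↥(maximalRealSubfield L)) L (IsCMField.complexConj L) (complexConj_imagUnit L)
      (imagUnit_ne_zero L) (imagUnit_mul_self L) v μ n hT₀ hT₀d rfl hs.choose hs.choose_spec
      (fun w' : PlacesOver L v => (χ.localComponent w'.1)⁻¹) (isTrivialNearOne_localComponent_inv L v χ hs.choose) := by
    rw [hDdef, localSplittingDatumCM, dif_pos hs]
  have hD' : D' = localSplittingDatumSplit (↥(maximalRealSubfield L)) L (IsCMField.complexConj L) (complexConj_imagUnit L)
      (imagUnit_ne_zero L) (imagUnit_mul_self L) v μ n hT₀ hT₀d rfl hs.choose hs.choose_spec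
      (fun w' : PlacesOver L v => (χ'.localComponent w'.1)⁻¹) (isTrivialNearOne_localComponent_inv L v χ' hs.choose) := by
    rw [hD'def, localSplittingDatumCM, dif_pos hs]
  -- the two data have the same Leray section (`L0D`)
  have hr : D'.r = D.r := by
    rw [hD, hD']
    rfl
  have heq' : undoubleLoc (↥(maximalRealSubfield L)) L (IsCMField.complexConj L) v n hJ rfl (complexConj_imagUnit L)
      (imagUnit_ne_zero L) (imagUnit_mul_self L) hT₀ hT₀d D.localSplitting D.proj_localSplitting =
      undoubleLoc (↥(maximalRealSubfield L)) L (IsCMField.complexConj L) v n hJ rfl (complexConj_imagUnit L)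
      (imagUnit_ne_zero L) (imagUnit_mul_self L) hT₀ hT₀d D'.localSplitting D'.proj_localSplitting := heq
  obtain ⟨κ, hκβ, hκs⟩ := LocalSplittingDatum.exists_betaRatioChar D D' hr
  -- the `β`'s are the split `β`'s: `λ_m(ι g) · χ_w⁻¹(det g_w)`
  have hβ : ∀ g, D.beta g = betaSplitDoubled (↥(maximalRealSubfield L)) L (IsCMField.complexConj L) (complexConj_imagUnit L)
      (imagUnit_ne_zero L) (imagUnit_mul_self L) v μ n hT₀ hT₀d rfl hs.choose hs.choose_spec
      (L0D (↥(maximalRealSubfield L)) v μ n hT₀d).hψ' (fun w' : PlacesOver L v => (χ.localComponent w'.1)⁻¹) g := by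
    intro g
    rw [hD]
    rfl
  have hβ' : ∀ g, D'.beta g = betaSplitDoubled (↥(maximalRealSubfield L)) L (IsCMField.complexConj L) (complexConj_imagUnit L)
      (imagUnit_ne_zero L) (imagUnit_mul_self L) v μ n hT₀ hT₀d rfl hs.choose hs.choose_spec
      (L0D (↥(maximalRealSubfield L)) v μ n hT₀d).hψ' (fun w' : PlacesOver L v => (χ'.localComponent w'.1)⁻¹) g := by
    intro g
    rw [hD']
    rfl
  -- `χ_w = χ'_w` at the place of record `w ∣ v`
  have hw₀eq : (χ.localComponent hs.choose.1)⁻¹ = (χ'.localComponent hs.choose.1)⁻¹ := by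
    refine MonoidHom.ext fun a => ?_
    obtain ⟨u, hu⟩ := exists_det_apply_eq_of_split (↥(maximalRealSubfield L)) L (IsCMField.complexConj L) v hc hn hT₀
      hT₀d hJ hs.choose hw₀ a
    have h1 := betaRatio_inlLoc_eq_one (↥(maximalRealSubfield L)) L (IsCMField.complexConj L) (complexConj_imagUnit L)
      (imagUnit_ne_zero L) (imagUnit_mul_self L) v μ n hT₀ hT₀d hJ rfl D D' κ hκs heq' u
    rw [hκβ, inv_mul_eq_one, hβ, hβ', betaSplitDoubled, betaSplitDoubled,
      det_inlLoc_apply (↥(maximalRealSubfield L)) L (IsCMField.complexConj L) v n hJ rfl u hs.choose, hu] at h1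
    exact (mul_left_cancel h1).symm
  have hcomp₀ : χ.localComponent hs.choose.1 = χ'.localComponent hs.choose.1 := inv_injective hw₀eq
  -- the conjugate place: `χ_{c⁻¹w} = χ_w⁻¹ ∘ c_*`
  have hcomp₁ : χ.localComponent (PlacesOver.galInv (IsCMField.complexConj L) hs.choose).1 =
      χ'.localComponent (PlacesOver.galInv (IsCMField.complexConj L) hs.choose).1 := by
    have t := isSplitPair_localComponent_inv L v χ hχ hs.choose hw₀
    have t' := isSplitPair_localComponent_inv L v χ' hχ' hs.choose hw₀
    refine inv_injective (MonoidHom.ext fun x => ?_)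
    rw [t x, t' x]
    beta_reduce
    rw [hw₀eq]
  have hall : ∀ w' : PlacesOver L v, χ.localComponent w'.1 = χ'.localComponent w'.1 := by
    intro w'
    rcases PlacesOver.eq_or_eq_galInv (IsCMField.complexConj L) hc hs.choose w' with h | h
    · rw [h]; exact hcomp₀
    · rw [h]; exact hcomp₁
  rw [localMu, localMu]
  exact Finset.prod_congr rfl fun w' _ => by rw [hall w']

/-- the same for the Borel/`addHaar` Haar data of record (`localSplittingCM`, the local components of the tree's
`finLocalSplittingsCM` ∕ `chiLocalSplittingsD`). [cite: Kudla1994, §3 Thm. 3.1] [cite: GelbartRogawski1991, §3.1 Remark p. 457 L4–13] -/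
theorem localMu_eq_of_localSplittingCM_eq_split (L : Type) [Field L] [NumberField L] [IsCMField L]
    {n : ℕ} (hn : 0 < n) {T₀ : Matrix (Fin n) (Fin n) ↥(maximalRealSubfield L)} (hT₀ : T₀.IsSymm) (hT₀d : IsUnit T₀.det)
    {J : Matrix (Fin n) (Fin n) L} (hJ : J = T₀.map (algebraMap ↥(maximalRealSubfield L) L)) (χ χ' : HeckeCharacter L)
    (hχ : IsSplittingChar L 1 χ) (hχ' : IsSplittingChar L 1 χ') (v : HeightOneSpectrum (𝓞 ↥(maximalRealSubfield L)))
    (hE : ¬ IsField (LocalRing L v))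
    (heq : localSplittingCM L n hT₀ hT₀d hJ χ hχ v = localSplittingCM L n hT₀ hT₀d hJ χ' hχ' v) :
    localMu L χ v = localMu L χ' v := by
  letI : MeasurableSpace (v.adicCompletion ↥(maximalRealSubfield L)) := borel _
  haveI : BorelSpace (v.adicCompletion ↥(maximalRealSubfield L)) := ⟨rfl⟩
  exact localMu_eq_of_localSplittingCMWith_eq_split L hn hT₀ hT₀d hJ χ χ' hχ hχ' v Measure.addHaar hE heq

end Literature.NumberTheory.GelbartRogawski1991.UnitaryDualPair.LocalSplitting

/-! ## §3 On the transported undoubled CM packages of record -/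

namespace Literature.NumberTheory.GelbartRogawski1991.GRConstruction

open UnitaryDualPair UnitaryDualPair.LocalSplitting

/-- **Equal members at a SPLIT place of the undoubled explicit CM packages of record of `χ` and `χ'` force
`μ_v(χ) = μ_v(χ')`** (any `e : Fin N × Fin M ≃ Fin n`, `n ≥ 1`; split twin of
`localMu_eq_of_congrW_undoubledSplittings_s_eq`): strip the transport (`subst`), identify both members with
`localSplittingCM … v` (`undouble_finSplittings_cmFinLocalFamily_s`), and apply `localMu_eq_of_localSplittingCM_eq_split`.
[cite: Kudla1994, §3 Thm. 3.1] [cite: GelbartRogawski1991, §3.1 Prop. 3.1.1 p. 455 L1–3] -/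
theorem localMu_eq_of_congrW_undoubledSplittings_s_eq_split (L : Type) [Field L] [NumberField L] [IsCMField L]
    {N M n : ℕ} (hn : 0 < n) (e : Fin N × Fin M ≃ Fin n) (dV : Fin N → L)
    (hdV : ∀ i, IsCMField.complexConj L (dV i) = dV i) (hdV0 : ∀ i, dV i ≠ 0) (dW : Fin M → L)
    (hdW : ∀ i, IsCMField.complexConj L (dW i) = dW i) (hdW0 : ∀ i, dW i ≠ 0)
    {TW' : Matrix (Fin M) (Fin M) (Fp L)} {JW' : Matrix (Fin M) (Fin M) L} (hT : realDiagonal L dW hdW = TW')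
    (hJ : Matrix.diagonal dW = JW') (hW' : TW'.IsSymm) (hJW' : JW' = TW'.map (algebraMap (Fp L) L))
    (χ χ' : HeckeCharacter L) (hχ : IsSplittingChar L 1 χ) (hχ' : IsSplittingChar L 1 χ')
    (v : HeightOneSpectrum (𝓞 (Fp L))) (hE : ¬ IsField (LocalRing L v))
    (h : (congrW L e dV hdV dW hdW hT hJ
        (undoubledSplittings L e dV hdV hdV0 dW hdW hdW0 χ (borelPlaceMeasure L)
          (cmFinLocalFamily L e dV hdV hdV0 dW hdW hdW0 χ hχ (borelPlaceMeasure L))) hW' hJW').s v =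
      (congrW L e dV hdV dW hdW hT hJ
        (undoubledSplittings L e dV hdV hdV0 dW hdW hdW0 χ' (borelPlaceMeasure L)
          (cmFinLocalFamily L e dV hdV hdV0 dW hdW hdW0 χ' hχ' (borelPlaceMeasure L))) hW' hJW').s v) :
    localMu L χ v = localMu L χ' v := by
  subst hT hJ
  change (undoubledSplittings L e dV hdV hdV0 dW hdW hdW0 χ (borelPlaceMeasure L)
        (cmFinLocalFamily L e dV hdV hdV0 dW hdW hdW0 χ hχ (borelPlaceMeasure L))).s v =
      (undoubledSplittings L e dV hdV hdV0 dW hdW hdW0 χ' (borelPlaceMeasure L)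
        (cmFinLocalFamily L e dV hdV hdV0 dW hdW hdW0 χ' hχ' (borelPlaceMeasure L))).s v at h
  have h3 : localSplittingCM L n (gramR_isSymm L e dV hdV dW hdW) (isUnit_det_gramR₀ L e dV hdV hdV0 dW hdW hdW0)
        (reindex_kronecker_eq_gram_map (Fp L) L e (realDiagonal_map L dV hdV).symm (realDiagonal_map L dW hdW).symm)
        χ hχ v =
      localSplittingCM L n (gramR_isSymm L e dV hdV dW hdW) (isUnit_det_gramR₀ L e dV hdV hdV0 dW hdW hdW0)
        (reindex_kronecker_eq_gram_map (Fp L) L e (realDiagonal_map L dV hdV).symm (realDiagonal_map L dW hdW).symm)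
        χ' hχ' v :=
    ((undouble_finSplittings_cmFinLocalFamily_s L e dV hdV hdV0 dW hdW hdW0 χ hχ _ v).symm.trans h).trans
      (undouble_finSplittings_cmFinLocalFamily_s L e dV hdV hdV0 dW hdW hdW0 χ' hχ' _ v)
  exact localMu_eq_of_localSplittingCM_eq_split L hn (gramR_isSymm L e dV hdV dW hdW)
    (isUnit_det_gramR₀ L e dV hdV hdV0 dW hdW hdW0) _ χ χ' hχ hχ' v hE h3

/-- **Equal members at ANY finite place of the undoubled explicit CM packages of record of `χ` and `χ'` force `μ_v(χ) = μ_v(χ')`**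
(rank `3`, any `e : Fin N × Fin M ≃ Fin 3`): by cases on `IsField (L ⊗ L⁺_v)` — the non-split case is
`localMu_eq_of_congrW_undoubledSplittings_s_eq` (`LocalKudlaSplittingInjectiveTransported`), the split case
`localMu_eq_of_congrW_undoubledSplittings_s_eq_split`.
[cite: Kudla1994, §3 Thm. 3.1] [cite: GelbartRogawski1991, §3.1 Prop. 3.1.1 p. 455 L1–3, Remark p. 457 L4–13] -/
theorem localMu_eq_of_congrW_undoubledSplittings_s_eq_three (L : Type) [Field L] [NumberField L] [IsCMField L]
    {N M : ℕ} (e : Fin N × Fin M ≃ Fin 3) (dV : Fin N → L)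
    (hdV : ∀ i, IsCMField.complexConj L (dV i) = dV i) (hdV0 : ∀ i, dV i ≠ 0) (dW : Fin M → L)
    (hdW : ∀ i, IsCMField.complexConj L (dW i) = dW i) (hdW0 : ∀ i, dW i ≠ 0)
    {TW' : Matrix (Fin M) (Fin M) (Fp L)} {JW' : Matrix (Fin M) (Fin M) L} (hT : realDiagonal L dW hdW = TW')
    (hJ : Matrix.diagonal dW = JW') (hW' : TW'.IsSymm) (hJW' : JW' = TW'.map (algebraMap (Fp L) L))
    (χ χ' : HeckeCharacter L) (hχ : IsSplittingChar L 1 χ) (hχ' : IsSplittingChar L 1 χ')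
    (v : HeightOneSpectrum (𝓞 (Fp L)))
    (h : (congrW L e dV hdV dW hdW hT hJ
        (undoubledSplittings L e dV hdV hdV0 dW hdW hdW0 χ (borelPlaceMeasure L)
          (cmFinLocalFamily L e dV hdV hdV0 dW hdW hdW0 χ hχ (borelPlaceMeasure L))) hW' hJW').s v =
      (congrW L e dV hdV dW hdW hT hJ
        (undoubledSplittings L e dV hdV hdV0 dW hdW hdW0 χ' (borelPlaceMeasure L)
          (cmFinLocalFamily L e dV hdV hdV0 dW hdW hdW0 χ' hχ' (borelPlaceMeasure L))) hW' hJW').s v) :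
    localMu L χ v = localMu L χ' v := by
  by_cases hE : IsField (LocalRing L v)
  · exact localMu_eq_of_congrW_undoubledSplittings_s_eq L e dV hdV hdV0 dW hdW hdW0 hT hJ hW' hJW' χ χ' hχ hχ' v hE h
  · exact localMu_eq_of_congrW_undoubledSplittings_s_eq_split L (by norm_num) e dV hdV hdV0 dW hdW hdW0 hT hJ hW' hJW'
      χ χ' hχ hχ' v hE h

end Literature.NumberTheory.GelbartRogawski1991.GRConstruction

end
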